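import Literature.MathematicalPhysics.QuantumFieldTheory.Balaban1983to89.FieldMeasureExpChartChangeOfVariables
import Literature.MathematicalPhysics.QuantumFieldTheory.Balaban1983to89.HaarExpChartChangeOfVariablesPiInverse

/-!
# `Balaban1983to89.FieldMeasureExpChartChangeOfVariablesInverse` — file 5 (`HaarExpChartChangeOfVariablesPiInverse`: [Balaban1985UV3] (18)
# ∕ [Helgason2000] (13) on a window READ RIGHT-TO-LEFT) AT THE CELL'S TYPES: flat window integrals over `T ⊆ B(0,s)^{PBond P j}` as
# integrals against `dU = fieldMeasure P j SU(N)` with the weight `1∕Π_b|det jac(Λ U_b)|` (also over translated windows `Θ^B(T)·U₀`), and the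
# coordinate window measure `(Θ^B)_*((⊗η)|_T)` as a weighted restriction of `dU` — the coarse-side step of the `hmap` assembly

statement-level skeleton of published theorems with citation tags; proofs where landed; nothing here is a claim
about the Yang–Mills mass gap

Cell `pub-ymgap`, seat `pub-ymgap-dag-n09-w4` (gen 4; node N09, helper lane of the K1⁷ item, count-neutral).  File 6 of the (F1) group-chart
composition; companion of file 4 (`FieldMeasureExpChartChangeOfVariables`, same tokens: `Θ = (isChartRep_specialUnitaryGroup (n := Fin N)).expChart`,
`|det jac| = jacDensity (lie_adStable_specialUnitaryGroup (n := Fin N))`, `σ₀` = its window constant `= 1∕∫_{alcove}|det jac| dη`).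

CONTENT (theorems only; 0 def, 0 instance, 0 sorry; axioms standard): `lintegral_fieldMeasure_image_div_eq`,
`lintegral_fieldMeasure_translate_image_div_eq`, `map_piChart_restrict_eq_smul_fieldMeasure_withDensity`,
`map_piChart_translate_restrict_eq_smul_fieldMeasure_withDensity` (window centred at any `U₀`) — one `exact` each over file 5; and
the DISCHARGE OF THE JACOBIAN HYPOTHESIS on `SU(N)`: `abs_eigenvalue_le_norm_specialUnitary`, `det_jac_specialUnitary_pos_of_norm_lt_pi`
(`det jac > 0` on the whole ball `‖A‖ < π`, the `SU(N)` twin of p28's `HaarUnitaryMaximalChart.det_jac_pos_of_norm_lt_pi`) and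
`det_jac_ne_zero_of_subset_pi_ball` — the `hjac` hypothesis of files 1–6 holds on EVERY window `T ⊆ B(0,s)^B`, `s ≤ s_C`.

HONEST SCOPE.  Instantiation only; nothing of Bałaban's asserted or estimated; no chart of Bałaban's constructed ((M3r) stays unowned);
`hreg`∕`contTOn`∕`regSet`∕`TcanOfRecord` untouched.
-/

noncomputable section

open NormedSpace Set Function Filter Topology MeasureTheory
open scoped ENNReal NNReal Matrix.Norms.L2Operator

namespace Literature.MathematicalPhysics.QuantumFieldTheory.Balaban1983to89.FieldMeasureExpChartChangeOfVariables

open HaarExponentialChart HaarExponentialChart.IsChartRep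
open B13HaarSigmaJacobian (jac)

/-! ## The coordinate window pushed BACK to `dU`: (18) read right-to-left at the cell's types -/

section Inverse

variable {N : ℕ} [NeZero N] (P : Params) (j : ℕ)
variable [MeasurableSpace (specialUnitaryLogChart (Fin N)).lie] [BorelSpace (specialUnitaryLogChart (Fin N)).lie]
  (η : Measure (specialUnitaryLogChart (Fin N)).lie) [η.IsAddHaarMeasure]

/-- **A FLAT WINDOW INTEGRAL AS A `dU`-INTEGRAL**: for `0 < s ≤ s_C`, a Borel `T ⊆ B(0,s)^B` (`B = PBond P j`) on which `det jac(X_b) ≠ 0`, and every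
`φ ≥ 0`: `∫_{Θ^B T} φ(Λ^B U) ∕ Π_b|det jac(Λ U_b)| dU = σ₀^{|B|} · ∫_T φ d(⊗η)` (file 5 `lintegral_pi_haar_image_div_eq` at `SU(N)`).
[cite: Balaban1985Averaging, (10) p. 19] [cite: Balaban1985UV3, (18) p. 260] [cite: Helgason2000, Ch. I §1 Thm. 1.14 (13) p. 96] -/
theorem lintegral_fieldMeasure_image_div_eq {s : ℝ} (hs0 : 0 < s) (hs : s ≤ chartRadius (specialUnitaryLogChart (Fin N)))
    {T : Set (PBond P j → (specialUnitaryLogChart (Fin N)).lie)} (hT : MeasurableSet T)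
    (hTs : T ⊆ Set.pi Set.univ fun _ => Metric.ball (0 : (specialUnitaryLogChart (Fin N)).lie) s)
    (hjac : ∀ X ∈ T, ∀ b, LinearMap.det (jac (lie_adStable_specialUnitaryGroup (n := Fin N)) (X b) :
      (specialUnitaryLogChart (Fin N)).lie →ₗ[ℝ] (specialUnitaryLogChart (Fin N)).lie) ≠ 0)
    (φ : (PBond P j → (specialUnitaryLogChart (Fin N)).lie) → ℝ≥0∞) :
    ∫⁻ U in (fun A b => (isChartRep_specialUnitaryGroup (n := Fin N)).expChart (A b)) '' T,
        φ (fun b => (isChartRep_specialUnitaryGroup (n := Fin N)).logChart (U b)) /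
          ∏ b, jacDensity (lie_adStable_specialUnitaryGroup (n := Fin N)) ((isChartRep_specialUnitaryGroup (n := Fin N)).logChart (U b))
        ∂(fieldMeasure P j (Matrix.specialUnitaryGroup (Fin N) ℂ)) =
      ((HaarData.haar : Measure (Matrix.specialUnitaryGroup (Fin N) ℂ)) ((isChartRep_specialUnitaryGroup (n := Fin N)).window s) /
          (isChartRep_specialUnitaryGroup (n := Fin N)).chartMeasure (lie_adStable_specialUnitaryGroup (n := Fin N)) η s
            ((isChartRep_specialUnitaryGroup (n := Fin N)).window s)) ^ Fintype.card (PBond P j) *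
        ∫⁻ X in T, φ X ∂(Measure.pi fun _ : PBond P j => η) := by
  haveI := isHaarMeasure_haar_specialUnitaryGroup (N := N)
  exact (isChartRep_specialUnitaryGroup (n := Fin N)).lintegral_pi_haar_image_div_eq (lie_adStable_specialUnitaryGroup (n := Fin N)) η
    (HaarData.haar : Measure (Matrix.specialUnitaryGroup (Fin N) ℂ)) (PBond P j) hs0 hs hT hTs hjac φ

/-- **THE SAME OVER A TRANSLATED WINDOW `Θ^B(T)·U₀`** (`Λ^B(U·U₀⁻¹)` in the integrand). [cite: Balaban1985Averaging, (10) p. 19]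
[cite: Balaban1985UV3, (18) p. 260] [cite: Helgason2000, Ch. I §1 Thm. 1.14 (13) p. 96] -/
theorem lintegral_fieldMeasure_translate_image_div_eq {s : ℝ} (hs0 : 0 < s) (hs : s ≤ chartRadius (specialUnitaryLogChart (Fin N)))
    {T : Set (PBond P j → (specialUnitaryLogChart (Fin N)).lie)} (hT : MeasurableSet T)
    (hTs : T ⊆ Set.pi Set.univ fun _ => Metric.ball (0 : (specialUnitaryLogChart (Fin N)).lie) s)
    (hjac : ∀ X ∈ T, ∀ b, LinearMap.det (jac (lie_adStable_specialUnitaryGroup (n := Fin N)) (X b) :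
      (specialUnitaryLogChart (Fin N)).lie →ₗ[ℝ] (specialUnitaryLogChart (Fin N)).lie) ≠ 0)
    (U₀ : GaugeField P j (Matrix.specialUnitaryGroup (Fin N) ℂ))
    (φ : (PBond P j → (specialUnitaryLogChart (Fin N)).lie) → ℝ≥0∞) :
    ∫⁻ U in (fun (U : GaugeField P j (Matrix.specialUnitaryGroup (Fin N) ℂ)) (b : PBond P j) => U b * U₀ b) ''
        ((fun A b => (isChartRep_specialUnitaryGroup (n := Fin N)).expChart (A b)) '' T),
        φ (fun b => (isChartRep_specialUnitaryGroup (n := Fin N)).logChart (U b * (U₀ b)⁻¹)) /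
          ∏ b, jacDensity (lie_adStable_specialUnitaryGroup (n := Fin N))
            ((isChartRep_specialUnitaryGroup (n := Fin N)).logChart (U b * (U₀ b)⁻¹))
        ∂(fieldMeasure P j (Matrix.specialUnitaryGroup (Fin N) ℂ)) =
      ((HaarData.haar : Measure (Matrix.specialUnitaryGroup (Fin N) ℂ)) ((isChartRep_specialUnitaryGroup (n := Fin N)).window s) /
          (isChartRep_specialUnitaryGroup (n := Fin N)).chartMeasure (lie_adStable_specialUnitaryGroup (n := Fin N)) η s
            ((isChartRep_specialUnitaryGroup (n := Fin N)).window s)) ^ Fintype.card (PBond P j) *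
        ∫⁻ X in T, φ X ∂(Measure.pi fun _ : PBond P j => η) := by
  haveI := isHaarMeasure_haar_specialUnitaryGroup (N := N)
  haveI : (HaarData.haar : Measure (Matrix.specialUnitaryGroup (Fin N) ℂ)).IsMulRightInvariant := isMulRightInvariant_haar
  exact (isChartRep_specialUnitaryGroup (n := Fin N)).lintegral_pi_haar_translate_image_div_eq
    (lie_adStable_specialUnitaryGroup (n := Fin N)) η (HaarData.haar : Measure (Matrix.specialUnitaryGroup (Fin N) ℂ)) (PBond P j)
    hs0 hs hT hTs hjac U₀ φ

/-- **THE COORDINATE WINDOW MEASURE AS A WEIGHTED RESTRICTION OF `dU`**: `(Θ^B)_*((⊗η)|_T) = (σ₀^{|B|})⁻¹ • (Π_b|det jac(Λ U_b)|)⁻¹ · dU|_{Θ^B T}`.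
[cite: Balaban1985Averaging, (10) p. 19] [cite: Balaban1985UV3, (18) p. 260] [cite: Helgason2000, Ch. I §1 Thm. 1.14 (13) p. 96] -/
theorem map_piChart_restrict_eq_smul_fieldMeasure_withDensity {s : ℝ} (hs0 : 0 < s) (hs : s ≤ chartRadius (specialUnitaryLogChart (Fin N)))
    {T : Set (PBond P j → (specialUnitaryLogChart (Fin N)).lie)} (hT : MeasurableSet T)
    (hTs : T ⊆ Set.pi Set.univ fun _ => Metric.ball (0 : (specialUnitaryLogChart (Fin N)).lie) s)
    (hjac : ∀ X ∈ T, ∀ b, LinearMap.det (jac (lie_adStable_specialUnitaryGroup (n := Fin N)) (X b) :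
      (specialUnitaryLogChart (Fin N)).lie →ₗ[ℝ] (specialUnitaryLogChart (Fin N)).lie) ≠ 0) :
    ((Measure.pi fun _ : PBond P j => η).restrict T).map
        (fun (A : PBond P j → (specialUnitaryLogChart (Fin N)).lie) (b : PBond P j) =>
          (isChartRep_specialUnitaryGroup (n := Fin N)).expChart (A b)) =
      (((HaarData.haar : Measure (Matrix.specialUnitaryGroup (Fin N) ℂ)) ((isChartRep_specialUnitaryGroup (n := Fin N)).window s) /
          (isChartRep_specialUnitaryGroup (n := Fin N)).chartMeasure (lie_adStable_specialUnitaryGroup (n := Fin N)) η s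
            ((isChartRep_specialUnitaryGroup (n := Fin N)).window s)) ^ Fintype.card (PBond P j))⁻¹ •
        ((fieldMeasure P j (Matrix.specialUnitaryGroup (Fin N) ℂ)).restrict
            ((fun A b => (isChartRep_specialUnitaryGroup (n := Fin N)).expChart (A b)) '' T)).withDensity
          (fun U => (∏ b, jacDensity (lie_adStable_specialUnitaryGroup (n := Fin N))
            ((isChartRep_specialUnitaryGroup (n := Fin N)).logChart (U b)))⁻¹) := by
  haveI := isHaarMeasure_haar_specialUnitaryGroup (N := N)
  exact (isChartRep_specialUnitaryGroup (n := Fin N)).map_piChart_restrict_eq_smul_withDensity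
    (lie_adStable_specialUnitaryGroup (n := Fin N)) η (HaarData.haar : Measure (Matrix.specialUnitaryGroup (Fin N) ℂ)) (PBond P j)
    hs0 hs hT hTs hjac

/-- **THE SAME FOR A WINDOW CENTRED AT ANY CONFIGURATION `U₀`**: `(A ↦ Θ^B(A)·U₀)_*((⊗η)|_T) = (σ₀^{|B|})⁻¹ • (Π_b|det jac(Λ(U_b·U₀(b)⁻¹))|)⁻¹ · dU|_{Θ^B(T)·U₀}`.
[cite: Balaban1985Averaging, (10) p. 19] [cite: Balaban1985UV3, (18) p. 260] [cite: Helgason2000, Ch. I §1 Thm. 1.14 (13) p. 96] -/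
theorem map_piChart_translate_restrict_eq_smul_fieldMeasure_withDensity {s : ℝ} (hs0 : 0 < s)
    (hs : s ≤ chartRadius (specialUnitaryLogChart (Fin N)))
    {T : Set (PBond P j → (specialUnitaryLogChart (Fin N)).lie)} (hT : MeasurableSet T)
    (hTs : T ⊆ Set.pi Set.univ fun _ => Metric.ball (0 : (specialUnitaryLogChart (Fin N)).lie) s)
    (hjac : ∀ X ∈ T, ∀ b, LinearMap.det (jac (lie_adStable_specialUnitaryGroup (n := Fin N)) (X b) :
      (specialUnitaryLogChart (Fin N)).lie →ₗ[ℝ] (specialUnitaryLogChart (Fin N)).lie) ≠ 0)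
    (U₀ : GaugeField P j (Matrix.specialUnitaryGroup (Fin N) ℂ)) :
    ((Measure.pi fun _ : PBond P j => η).restrict T).map
        (fun (A : PBond P j → (specialUnitaryLogChart (Fin N)).lie) (b : PBond P j) =>
          (isChartRep_specialUnitaryGroup (n := Fin N)).expChart (A b) * U₀ b) =
      (((HaarData.haar : Measure (Matrix.specialUnitaryGroup (Fin N) ℂ)) ((isChartRep_specialUnitaryGroup (n := Fin N)).window s) /
          (isChartRep_specialUnitaryGroup (n := Fin N)).chartMeasure (lie_adStable_specialUnitaryGroup (n := Fin N)) η s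
            ((isChartRep_specialUnitaryGroup (n := Fin N)).window s)) ^ Fintype.card (PBond P j))⁻¹ •
        ((fieldMeasure P j (Matrix.specialUnitaryGroup (Fin N) ℂ)).restrict
            ((fun (U : GaugeField P j (Matrix.specialUnitaryGroup (Fin N) ℂ)) (b : PBond P j) => U b * U₀ b) ''
              ((fun A b => (isChartRep_specialUnitaryGroup (n := Fin N)).expChart (A b)) '' T))).withDensity
          (fun U => (∏ b, jacDensity (lie_adStable_specialUnitaryGroup (n := Fin N))
            ((isChartRep_specialUnitaryGroup (n := Fin N)).logChart (U b * (U₀ b)⁻¹)))⁻¹) := by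
  haveI := isHaarMeasure_haar_specialUnitaryGroup (N := N)
  haveI : (HaarData.haar : Measure (Matrix.specialUnitaryGroup (Fin N) ℂ)).IsMulRightInvariant := isMulRightInvariant_haar
  exact (isChartRep_specialUnitaryGroup (n := Fin N)).map_piChart_translate_restrict_eq_smul_withDensity
    (lie_adStable_specialUnitaryGroup (n := Fin N)) η (HaarData.haar : Measure (Matrix.specialUnitaryGroup (Fin N) ℂ)) (PBond P j)
    hs0 hs hT hTs hjac U₀

end Inverse

/-! ## The Jacobian hypothesis `det jac(X_b) ≠ 0` holds on EVERY window of the `SU(N)` chart (`‖X_b‖ < s ≤ s_C < π`) -/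

section JacobianPos

variable {N : ℕ} [NeZero N]

/-- `|θ_j(A)| ≤ ‖A‖` for `A ∈ 𝔰𝔲(N)`, `θ(A)` the eigenvalues of the Hermitian matrix `−iA` (as p28's `HaarUnitaryMaximalChart.abs_eigenvalue_le_norm`
for `𝔲(N)`; Mathlib `spectrum.norm_le_norm_of_mem`). [cite: Balaban1985Averaging, (23)–(24) p. 21] -/
theorem abs_eigenvalue_le_norm_specialUnitary (A : (specialUnitaryLogChart (Fin N)).lie) (j : Fin N) :
    |(HaarDensityUnitaryExplicit.isHermitian_neg_I_smul
        (HaarDensityUnitaryChart.conjTranspose_eq_neg_of_mem_specialUnitaryLogChart A)).eigenvalues j| ≤ ‖A‖ := by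
  set hH := HaarDensityUnitaryExplicit.isHermitian_neg_I_smul
    (HaarDensityUnitaryChart.conjTranspose_eq_neg_of_mem_specialUnitaryLogChart A)
  have h1 : ((hH.eigenvalues j : ℝ) : ℂ) ∈ spectrum ℂ ((-Complex.I) • (A : Matrix (Fin N) (Fin N) ℂ)) := by
    have := spectrum.algebraMap_mem ℂ (hH.eigenvalues_mem_spectrum_real j)
    rwa [Complex.coe_algebraMap] at this
  have h2 := spectrum.norm_le_norm_of_mem h1
  rw [Complex.norm_real, Real.norm_eq_abs, norm_smul, norm_neg, Complex.norm_I, one_mul] at h2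
  exact h2

/-- **`det jac > 0` ON THE WHOLE BALL `‖A‖ < π` OF THE `SU(N)` CHART**: `det jac(A) = Π_j Π_k sinc((θ_j − θ_k)∕2)` (p28 gen 12
`HaarDensityUnitaryChart.det_jac_specialUnitaryLogChart_eq_prod_sinc`) with `|θ_j − θ_k|∕2 ≤ ‖A‖ < π` — the `SU(N)` twin of p28's
`HaarUnitaryMaximalChart.det_jac_pos_of_norm_lt_pi`. [cite: Balaban1985UV3, p. 260] [cite: Helgason2000, Ch. I §1 Thm. 1.14 (12) p. 96] -/
theorem det_jac_specialUnitary_pos_of_norm_lt_pi (A : (specialUnitaryLogChart (Fin N)).lie) (hA : ‖A‖ < Real.pi) :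
    0 < LinearMap.det (jac (lie_adStable_specialUnitaryGroup (n := Fin N)) A :
      (specialUnitaryLogChart (Fin N)).lie →ₗ[ℝ] (specialUnitaryLogChart (Fin N)).lie) := by
  have hsinc : ∀ x : ℝ, |x| < Real.pi → 0 < Real.sinc x := by
    intro x hx
    rcases eq_or_ne x 0 with rfl | h0
    · rw [Real.sinc_zero]; exact one_pos
    rw [Real.sinc_of_ne_zero h0]
    rw [abs_lt] at hx
    rcases lt_or_gt_of_ne h0 with hneg | hpos
    · exact div_pos_of_neg_of_neg (Real.sin_neg_of_neg_of_neg_pi_lt hneg hx.1) hneg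
    · exact div_pos (Real.sin_pos_of_pos_of_lt_pi hpos hx.2) hpos
  rw [HaarDensityUnitaryChart.det_jac_specialUnitaryLogChart_eq_prod_sinc A]
  refine Finset.prod_pos fun j _ => Finset.prod_pos fun k _ => hsinc _ ?_
  have hj := abs_eigenvalue_le_norm_specialUnitary A j
  have hk := abs_eigenvalue_le_norm_specialUnitary A k
  rw [abs_lt]
  rw [abs_le] at hj hk
  constructor <;> linarith

/-- **THE JACOBIAN HYPOTHESIS OF FILES 1–6 IS AUTOMATIC ON `SU(N)` WINDOWS**: for `T ⊆ B(0,s)^B` with `s ≤ s_C` (indeed any `s ≤ π`),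
`det jac(X_b) ≠ 0` for every `X ∈ T` and every bond `b` (`s_C ≤ r_C ≤ ½ < π`). [cite: Balaban1985UV3, p. 260] [cite: Helgason2000, Ch. I §1 Thm. 1.14 (12) p. 96] -/
theorem det_jac_ne_zero_of_subset_pi_ball {B : Type*} {s : ℝ} (hs : s ≤ chartRadius (specialUnitaryLogChart (Fin N)))
    {T : Set (B → (specialUnitaryLogChart (Fin N)).lie)}
    (hTs : T ⊆ Set.pi Set.univ fun _ => Metric.ball (0 : (specialUnitaryLogChart (Fin N)).lie) s) :
    ∀ X ∈ T, ∀ b, LinearMap.det (jac (lie_adStable_specialUnitaryGroup (n := Fin N)) (X b) :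
      (specialUnitaryLogChart (Fin N)).lie →ₗ[ℝ] (specialUnitaryLogChart (Fin N)).lie) ≠ 0 := by
  intro X hX b
  have hπ : s < Real.pi := by
    have h1 := chartRadius_le_innerRadius (C := specialUnitaryLogChart (Fin N))
    have h2 := innerRadius_le_half (C := specialUnitaryLogChart (Fin N))
    have h3 : (1 : ℝ) / 2 < Real.pi := by linarith [Real.pi_gt_three]
    linarith
  exact (det_jac_specialUnitary_pos_of_norm_lt_pi (X b)
    (lt_trans (mem_ball_zero_iff.1 (hTs hX b (Set.mem_univ b))) hπ)).ne'

end JacobianPos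


end Literature.MathematicalPhysics.QuantumFieldTheory.Balaban1983to89.FieldMeasureExpChartChangeOfVariables
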